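import Literature.NumberTheory.EllipticCurves.PadicLogFiniteExtension
import Literature.NumberTheory.EllipticCurves.VariableChangePoints
import HarnessLib

/-!
# `log_ω` under a dilation `(x, y) ↦ (u⁻²x, u⁻³y)`: `log_{ω'}(C • P) = u · log_ω(P)` — PROVED

Topic `NumberTheory/EllipticCurves`; sequel of `PadicLogFiniteExtension.lean` (`limitLog`,
`padicLogPointFiniteExt` over a valued field). THEOREMS ONLY. Cell `bsd-schneider-ideate`, seat
`bsd-schneider-door-c3` (prover, gen 9); consumer: the descent of Castella–Hsieh's value formula
(Math. Ann. 370 (2018) Lemma 5.4 / Thm. 5.7: `log_ω` of a Heegner point over the RAMIFIED completion of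
`K[p]`) along the untwisting isomorphism `ι_θ : E^{(d)} ≅ E`, `(x, y) ↦ (x/θ², y/θ³)` (`θ² = d`; tree
`untwistAt`, `untwistEquivAt`), needed by route `SchneiderFreeAdditiveX3`'s input `KYRead.KYReadCHValue`
(door-c3 gen 8 addendum (b): "`log z² = (p*)^{±1} · log Q²`").

## Statement
For a change of variables `C = (u, 0, 0, 0)` (a DILATION: `x' = u⁻²x`, `y' = u⁻³y`; Silverman,
*AEC* III.1 Table 3.1) the local parameter scales as `z' = -x'/y' = u·z` (`zCoord_pointMap_of_dilation`),
hence — `ι_C : V(K) ≃+ (C • V)(K)` being additive — so do the limits `z(pʳ·Q)/pʳ`: for `|u| ≤ 1` the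
dilation maps the kernel of reduction into the kernel of reduction and the level `E⁽ᵖ⁾` into the level
(`pointMap_mem_kernel_of_dilation`, `pointMap_mem_level_of_dilation`), `ℓ_p(ι_C Q) = u·ℓ_p(Q)` on `E⁽ᵖ⁾`
(`limitLog_pointMap_of_dilation`) and, for every point with a multiple in the level,

  `padicLogPointFiniteExt w (C • V) p (ι_C P) = u · padicLogPointFiniteExt w V p P`

(`padicLogPointFiniteExt_pointMap_of_dilation`). This is the transformation `ω' = u⁻¹ω`… read on the
logarithm: `log_{ω'} = ∫ω'` and `ω = dx/(2y + …)`, `ω' = u·ω`-normalisation of *AEC* III.1 Table 3.1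
("`ω' = u⁻¹ω`" for `(x, y) = (u²x', u³y')`; here the map goes the other way), i.e. the invariant
differential of the dilated model pulls back to `u` times that of `V`. The hypothesis `|u| ≤ 1` is the
direction in which levels are preserved (for `|u| > 1` apply the statement to `C⁻¹`); both models are
assumed `w`-integral. Over `ℚ_p`/finite extensions the (SPEC) hypotheses are discharged by
`limitLog_spec_of_completeSpace`.

References: Silverman, *AEC* III.1 Table 3.1 (`u⁻¹ω`), IV.1 (`z = -x/y`), Thm. IV.6.4 with Prop.
VII.2.2 (the logarithm); Mazur–Tate–Teitelbaum §II (`log(P) = log([m]P)/m`).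
-/

noncomputable section

open scoped Classical NNReal

namespace Literature.NumberTheory.EllipticCurves.FormalGroupChart

open _root_.WeierstrassCurve _root_.WeierstrassCurve.VariableChange

variable {K : Type*} [Field K] {w : Valuation K ℝ≥0} {V : WeierstrassCurve K} {p : ℕ}
  {C : _root_.WeierstrassCurve.VariableChange K}

/-! ### The chart parameter under a dilation -/

/-- **`z(ι_C P) = u · z(P)` for a dilation `C = (u, 0, 0, 0)`** (`x' = u⁻²x`, `y' = u⁻³y`, so
`-x'/y' = u · (-x/y)`; also when `y = 0`, both sides being the junk value `0`).
[cite: SilvermanAEC2009, III.1 Table 3.1 (x = u²x', y = u³y')] -/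
theorem zCoord_pointMap_of_dilation (hr : C.r = 0) (hs : C.s = 0) (ht : C.t = 0)
    (P : V.toAffine.Point) : (pointMap V C P).zCoord = (C.u : K) * P.zCoord := by
  rcases P with _ | ⟨x, y, h⟩
  · simp only [pointMap, WeierstrassCurve.Affine.Point.zCoord_zero', mul_zero]
  · rw [pointMap_some, WeierstrassCurve.Affine.Point.zCoord_some, WeierstrassCurve.Affine.Point.zCoord_some,
      toX_def, toY_def, hr, hs, ht, Units.val_inv_eq_inv_val]
    simp only [sub_zero, zero_mul]
    have hu : (C.u : K) ≠ 0 := C.u.ne_zero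
    by_cases hy : y = 0
    · simp [hy]
    · field_simp

variable [hV : V.IsIntegral w.integer] [hV' : (C • V).IsIntegral w.integer]

/-- **A dilation with `|u| ≤ 1` maps `E₁` into `E₁`**: `|u⁻²x| ≥ |x| > 1`.
[cite: SilvermanAEC2009, Prop. VII.2.2 (E₁: |x| > 1)] -/
theorem pointMap_mem_kernel_of_dilation (hr : C.r = 0)
    (hu : w (C.u : K) ≤ 1) {P : V.toAffine.Point} (hP : P ∈ kernel w V) :
    pointMap V C P ∈ kernel w (C • V) := by
  rcases P with _ | ⟨x, y, h⟩
  · exact (kernel w (C • V)).zero_mem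
  · rw [pointMap_some]
    refine some_mem_kernel _ ?_
    have hx : 1 < w x := (some_mem_kernel_iff h).mp hP
    have hu0 : w (C.u : K) ≠ 0 := (Valuation.ne_zero_iff w).mpr C.u.ne_zero
    rw [toX_def, hr, sub_zero, map_mul, map_pow, Units.val_inv_eq_inv_val, map_inv₀]
    have h1 : 1 ≤ (w (C.u : K))⁻¹ := one_le_inv_iff₀.mpr ⟨pos_iff_ne_zero.mpr hu0, hu⟩
    calc (1 : ℝ≥0) = 1 ^ 2 * 1 := by ring
      _ < (w (C.u : K))⁻¹ ^ 2 * w x := by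
        exact mul_lt_mul' (pow_le_pow_left' h1 2) hx zero_le (by positivity)

/-- **A dilation with `|u| ≤ 1` maps the level `E⁽ᵗ⁾` into the level `E⁽ᵗ⁾`** (`|z'| = |u||z| ≤ |z|`).
[cite: SilvermanAEC2009, Prop. VII.2.2] -/
theorem pointMap_mem_level_of_dilation (hr : C.r = 0) (hs : C.s = 0) (ht : C.t = 0)
    (hu : w (C.u : K) ≤ 1) {t : ℝ≥0} {P : V.toAffine.Point} (hP : P ∈ level w V t) :
    pointMap V C P ∈ level w (C • V) t := by
  refine ⟨pointMap_mem_kernel_of_dilation hr hu hP.1, ?_⟩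
  rw [zCoord_pointMap_of_dilation hr hs ht, map_mul]
  exact (mul_le_of_le_one_left' hu).trans hP.2

omit hV hV' in
/-- Uniqueness of `|p|`-adic limits: two values approximating the same sequence to within `|p|^{r+1}`
for every `r` are equal (`|p| < 1`). [cite: SilvermanAEC2009, Thm. IV.6.4 (uniqueness of the limit)] -/
private theorem eq_of_forall_val_sub_le_pow' (hp1 : w (p : K) < 1) {x : ℕ → K} {y y' : K}
    (hy : ∀ r, w (y - x r) ≤ w (p : K) ^ (r + 1)) (hy' : ∀ r, w (y' - x r) ≤ w (p : K) ^ (r + 1)) :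
    y = y' := by
  by_contra hne
  have hpos : 0 < w (y - y') := pos_iff_ne_zero.mpr (by rwa [Valuation.ne_zero_iff, sub_ne_zero])
  obtain ⟨r, hr⟩ := exists_pow_lt_of_lt_one hpos hp1
  have hle : w (y - y') ≤ w (p : K) ^ (r + 1) := by
    have e : y - y' = (y - x r) - (y' - x r) := by ring
    rw [e]
    exact (Valuation.map_sub w _ _).trans (max_le (hy r) (hy' r))
  have hlt : w (p : K) ^ (r + 1) ≤ w (p : K) ^ r := by
    rw [pow_succ]
    exact mul_le_of_le_one_right' hp1.le
  exact absurd (hle.trans hlt) (not_le.mpr hr)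

omit hV' in
/-- **`ℓ_p(ι_C Q) = u · ℓ_p(Q)` on the level `E⁽ᵖ⁾`, for a dilation with `|u| ≤ 1`**: the limits
`z(pʳ·Q)/pʳ` scale by `u` (`ι_C` is additive and `z ∘ ι_C = u·z`), and `u·ℓ_p(Q)` approximates the
dilated sequence to within `|u||p|^{r+1} ≤ |p|^{r+1}`. Hypothesis `hℓ`: (SPEC) for `limitLog` on the
level of `V` (e.g. `limitLog_spec_of_completeSpace`). [cite: SilvermanAEC2009, Thm. IV.6.4 with III.1 Table 3.1] -/
theorem limitLog_pointMap_of_dilation (hp1 : w (p : K) < 1) (hr : C.r = 0) (hs : C.s = 0)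
    (ht : C.t = 0) (hu : w (C.u : K) ≤ 1)
    (hℓ : ∀ Q ∈ level w V (w (p : K)), ∀ r : ℕ,
      w (limitLog w V p Q - ((p ^ r) • Q).zCoord / (p : K) ^ r) ≤ w (p : K) ^ (r + 1))
    {Q : V.toAffine.Point} (hQ : Q ∈ level w V (w (p : K))) :
    limitLog w (C • V) p (pointMap V C Q) = (C.u : K) * limitLog w V p Q := by
  -- `u · ℓ_p(Q)` has (SPEC) for the dilated point
  have hy : ∀ r : ℕ, w ((C.u : K) * limitLog w V p Q -
      ((p ^ r) • pointMap V C Q).zCoord / (p : K) ^ r) ≤ w (p : K) ^ (r + 1) := by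
    intro r
    have e : ((p ^ r) • pointMap V C Q).zCoord = (C.u : K) * ((p ^ r) • Q).zCoord := by
      rw [← pointEquiv_apply, ← map_nsmul, pointEquiv_apply, zCoord_pointMap_of_dilation hr hs ht]
    rw [e, mul_div_assoc, ← mul_sub, map_mul]
    exact (mul_le_of_le_one_left' hu).trans (hℓ Q hQ r)
  -- hence `limitLog` of the dilated point has (SPEC) too, and the two limits coincide
  exact eq_of_forall_val_sub_le_pow' hp1 (limitLog_spec_of_exists ⟨_, hy⟩) hy

/-- **`log_{ω'}(ι_C P) = u · log_ω(P)` for a dilation `C = (u, 0, 0, 0)` with `|u| ≤ 1`**, for every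
point `P` having a positive multiple in the level `E⁽ᵖ⁾` of `V` (always the case over a finite extension
of `ℚ_p` for points of nonsingular reduction): `log(ι_C P) = ℓ_p(m • ι_C P)/m = ℓ_p(ι_C (m • P))/m =
u·ℓ_p(m • P)/m = u·log(P)` (`padicLogPointFiniteExt_eq_div` on both models). Hypotheses `hℓ`, `hℓ'`:
(SPEC) for `limitLog` on the levels of `V` and of `C • V` (both from `limitLog_spec_of_completeSpace`).
This is the invariant-differential rule `ω' = u·ω` of Silverman *AEC* III.1 Table 3.1 read on
`log = ∫ω`; the case `C = untwistAt θ` (`u = θ`, `θ² = d`) is the twist descent of the logarithm.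
[cite: SilvermanAEC2009, III.1 Table 3.1 with Thm. IV.6.4 and Prop. VII.2.2]
[cite: MazurTateTeitelbaum1986, §II (log P = log(mP)/m)] -/
theorem padicLogPointFiniteExt_pointMap_of_dilation (hp0 : (p : K) ≠ 0) (hp1 : w (p : K) < 1)
    (hr : C.r = 0) (hs : C.s = 0) (ht : C.t = 0) (hu : w (C.u : K) ≤ 1)
    (hℓ : ∀ Q ∈ level w V (w (p : K)), ∀ r : ℕ,
      w (limitLog w V p Q - ((p ^ r) • Q).zCoord / (p : K) ^ r) ≤ w (p : K) ^ (r + 1))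
    (hℓ' : ∀ Q ∈ level w (C • V) (w (p : K)), ∀ r : ℕ,
      w (limitLog w (C • V) p Q - ((p ^ r) • Q).zCoord / (p : K) ^ r) ≤ w (p : K) ^ (r + 1))
    {P : V.toAffine.Point} {m : ℕ} (hm : 0 < m) (hmP : m • P ∈ level w V (w (p : K))) :
    padicLogPointFiniteExt w (C • V) p (pointMap V C P) =
      (C.u : K) * padicLogPointFiniteExt w V p P := by
  have hmP' : m • pointMap V C P ∈ level w (C • V) (w (p : K)) := by
    rw [← pointEquiv_apply, ← map_nsmul, pointEquiv_apply]
    exact pointMap_mem_level_of_dilation hr hs ht hu hmP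
  rw [padicLogPointFiniteExt_eq_div hp0 hp1 hℓ' hm hmP', padicLogPointFiniteExt_eq_div hp0 hp1 hℓ hm hmP,
    ← pointEquiv_apply, ← map_nsmul, pointEquiv_apply,
    limitLog_pointMap_of_dilation hp1 hr hs ht hu hℓ hmP, mul_div_assoc]

/-- The same along the additive equivalence `pointEquiv V C` (`= pointMap`, by definition).
[cite: SilvermanAEC2009, III.1 Table 3.1 with Thm. IV.6.4] -/
theorem padicLogPointFiniteExt_pointEquiv_of_dilation (hp0 : (p : K) ≠ 0) (hp1 : w (p : K) < 1)
    (hr : C.r = 0) (hs : C.s = 0) (ht : C.t = 0) (hu : w (C.u : K) ≤ 1)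
    (hℓ : ∀ Q ∈ level w V (w (p : K)), ∀ r : ℕ,
      w (limitLog w V p Q - ((p ^ r) • Q).zCoord / (p : K) ^ r) ≤ w (p : K) ^ (r + 1))
    (hℓ' : ∀ Q ∈ level w (C • V) (w (p : K)), ∀ r : ℕ,
      w (limitLog w (C • V) p Q - ((p ^ r) • Q).zCoord / (p : K) ^ r) ≤ w (p : K) ^ (r + 1))
    {P : V.toAffine.Point} {m : ℕ} (hm : 0 < m) (hmP : m • P ∈ level w V (w (p : K))) :
    padicLogPointFiniteExt w (C • V) p (pointEquiv V C P) =
      (C.u : K) * padicLogPointFiniteExt w V p P := by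
  rw [pointEquiv_apply]
  exact padicLogPointFiniteExt_pointMap_of_dilation hp0 hp1 hr hs ht hu hℓ hℓ' hm hmP

end Literature.NumberTheory.EllipticCurves.FormalGroupChart

end
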